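import Summits.QuantumFields.YangMills.Theorems.UnitScaleTiltProp7PinnedBiharmonicAgmonLetters
import HarnessLib

/-!
# Route `UnitScaleTilt`, crux K1 «MinimiserStabilityRegPr» (stmt-QuantumFields-19200), route-R E′ path (α′), sup row (hK) — (D2′) AGMON, ANNEX:
# WEIGHTED LOCALITY OF `Δ` AND THE PIN-RESTRICTED BOUND ON THE SCREENING CHARGES `q = Δ²w|_C`
# `Σ_{y∈S} (ω(y)·(Δ²w)(y))² ≤ 26d²c⁴·Σ_x (ω(x)·(Δw)(x))²`

Cell `ym3-torus`, D-0154 (3c) width seat `ym-routeR-w6` (gen 5); answer to ★routeR-w3 g5 19:08:11Z «can §3 emit the pin-restricted `Δ²` weighted bound?»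
for the (A3′) design (Δ-level peeling via the explicit screening charges `q_b = Δ²w_b|_C` of ✓p657675); `--supports stmt-QuantumFields-19200`,
count-neutral.  THEOREMS ONLY (0 `def`, 0 `sorry`).  YM₃ on T³ is a ladder rung (R3), not the Clay problem; nothing here claims the stub, the crux,
d = 4 or the gap.

THE POINT.  The lattice Laplacian is LOCAL (7-point stencil), so any weighted `ℓ²` bound on `u` is one on `Δu` with the factor `26d²c⁴` (weight rows
`a ≤ 1∕2` move `ω` across one bond at cost `3∕2`).  With `u = Δw_b` and ✓ `…AgmonDecay.weighted_laplace_le_core`'s `‖ωΔw_b‖` this gives the weighted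
`ℓ²` size of the screening charges `q_b(y) = (Δ²w_b)(y)`, `y ∈ C` — the row ★routeR-w3 g5 asked for.  SCALE WARNING (numbers): the stencil sees each
pin through its 7 neighbours only, so the bound inherits exactly the weighted size of `Δw_b` (after (A)'s peeling `~ℓ^{−1∕2}`), i.e. `|q_b(y)| ≲
ω(y)⁻¹ℓ^{−1∕2}`; the SCREENING size `|q_b(y)| ~ ℓ⁻¹` (charges of spacing ℓ carrying an O(1) dipole moment) that a near-field budget
`Σ_{r≤ℓ}r²·|q|r⁻¹ ≍ |q|ℓ² ≲ ℓ` needs is NOT visible to locality: the missing `ℓ^{−1∕2}` is the capacity∕non-concentration fact «a pin charge `q` spreads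
`Δ`-energy `≳ q²R` over `B_R`» (`Σ_{B_R(y)}(Δw)² ≥ c₀q²R` when `Δ²w = qδ_y` on `B_R(y)`), an elliptic LOWER bound of `G₁ ≳ r⁻¹` type — not here.

WHAT IS PROVED (ns `…Theorems.Prop7PinnedBiharmonicAgmonPinCharges`; real site fields, `LatticeFieldCalculus` letters, lattice factor `c`).
* ★ `sum_sq_weighted_laplace_le` — `Σ_x (ω·Δu)² ≤ 26d²c⁴·Σ_x (ω·u)²` under the first-difference weight row (`a ≤ 1∕2`).
* ★ `sum_sq_weighted_bilaplace_on_le` — for any `S : Finset (Site P j)`: `Σ_{y∈S} (ω(y)(Δ(Δw))(y))² ≤ 26d²c⁴·Σ_x (ω(x)(Δw)(x))²`.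
HONEST SCOPE.  Stencil bookkeeping only; see the scale warning.

References: T. Bałaban, CMP 95 (1984) 17–40 [Balaban1984PropagatorsI] ((1.21) p.21).
-/

set_option autoImplicit false

noncomputable section

open scoped BigOperators

namespace Summit.QuantumFields.YangMills.Theorems.Prop7PinnedBiharmonicAgmonPinCharges

open Literature.MathematicalPhysics.QuantumFieldTheory.Balaban1983to89
open Finset LatticeFieldCalculus
open B10StarCount (sum_pbond shift_unshift unshift_shift)
open Summit.QuantumFields.YangMills.Theorems.Prop7CentreHarmonicInterpKernel (sum_comp_shift sum_comp_unshift')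
open Summit.QuantumFields.YangMills.Theorems.Prop7PinnedBiharmonicAgmonLetters

variable {P : Params} {j : ℕ}

/-- pointwise stencil bound: `(ω(x)(Δu)(x))² ≤ 3d·c⁴·Σ_μ (4(ω u(x))² + (ω(x)u(x+e_μ))² + (ω(x)u(x−e_μ))²)`. [folklore] -/
theorem sq_weighted_laplace_le (c : ℝ) (ω u : SiteField P j ℝ) (x : Site P j) :
    (ω x * laplace c u x) ^ 2
      ≤ 3 * P.d * c ^ 4 * ∑ μ : Fin P.d, (4 * (ω x * u x) ^ 2 + (ω x * u (x.shift μ)) ^ 2 + (ω x * u (x.unshift μ)) ^ 2) := by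
  have e1 : ω x * laplace c u x = c ^ 2 * ∑ μ : Fin P.d, (2 * (ω x * u x) - ω x * u (x.shift μ) - ω x * u (x.unshift μ)) := by
    simp only [laplace, smul_eq_mul, Finset.mul_sum]
    exact Finset.sum_congr rfl fun μ _ => by ring
  rw [e1, mul_pow, show (c ^ 2) ^ 2 = c ^ 4 by ring]
  have h2 : (∑ μ : Fin P.d, (2 * (ω x * u x) - ω x * u (x.shift μ) - ω x * u (x.unshift μ))) ^ 2
      ≤ (Finset.univ : Finset (Fin P.d)).card
        * ∑ μ : Fin P.d, (2 * (ω x * u x) - ω x * u (x.shift μ) - ω x * u (x.unshift μ)) ^ 2 := sq_sum_le_card_mul_sum_sq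
  rw [Finset.card_univ, Fintype.card_fin] at h2
  have h3 : ∀ μ : Fin P.d, (2 * (ω x * u x) - ω x * u (x.shift μ) - ω x * u (x.unshift μ)) ^ 2
      ≤ 3 * (4 * (ω x * u x) ^ 2 + (ω x * u (x.shift μ)) ^ 2 + (ω x * u (x.unshift μ)) ^ 2) := by
    intro μ
    nlinarith [sq_nonneg (2 * (ω x * u x) + ω x * u (x.shift μ)), sq_nonneg (2 * (ω x * u x) + ω x * u (x.unshift μ)),
      sq_nonneg (ω x * u (x.shift μ) - ω x * u (x.unshift μ))]
  have hd : (0 : ℝ) ≤ P.d := Nat.cast_nonneg _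
  calc c ^ 4 * (∑ μ : Fin P.d, (2 * (ω x * u x) - ω x * u (x.shift μ) - ω x * u (x.unshift μ))) ^ 2
      ≤ c ^ 4 * (P.d * ∑ μ : Fin P.d, 3 * (4 * (ω x * u x) ^ 2 + (ω x * u (x.shift μ)) ^ 2 + (ω x * u (x.unshift μ)) ^ 2)) :=
        mul_le_mul_of_nonneg_left (h2.trans (mul_le_mul_of_nonneg_left (Finset.sum_le_sum fun μ _ => h3 μ) hd)) (by positivity)
    _ = 3 * P.d * c ^ 4 * ∑ μ : Fin P.d, (4 * (ω x * u x) ^ 2 + (ω x * u (x.shift μ)) ^ 2 + (ω x * u (x.unshift μ)) ^ 2) := by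
        rw [← Finset.mul_sum]; ring

/-- ★ **WEIGHTED LOCALITY OF `Δ`**: under the first-difference weight row (`a ≤ 1∕2`), `Σ_x (ω(x)(Δu)(x))² ≤ 26·d²·c⁴·Σ_x (ω(x)u(x))²`.
[cite: Balaban1984PropagatorsI, (1.21) p.21] -/
theorem sum_sq_weighted_laplace_le (c : ℝ) (ω u : SiteField P j ℝ) {a : ℝ} (ha : a ≤ 1 / 2) (hω₀ : ∀ x, 0 < ω x)
    (hω₁ : ∀ x μ, |ω (x.shift μ) - ω x| ≤ a * ω x ∧ |ω (x.unshift μ) - ω x| ≤ a * ω x) :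
    ∑ x : Site P j, (ω x * laplace c u x) ^ 2 ≤ 26 * (P.d : ℝ) ^ 2 * c ^ 4 * ∑ x : Site P j, (ω x * u x) ^ 2 := by
  have hd : (0 : ℝ) ≤ P.d := Nat.cast_nonneg _
  -- the two shifted sums are controlled by the unshifted one
  have hs : ∀ μ : Fin P.d, ∑ x : Site P j, (ω x * u (x.shift μ)) ^ 2 ≤ 9 / 4 * ∑ x : Site P j, (ω x * u x) ^ 2 := by
    intro μ
    rw [← sum_comp_unshift' μ (fun x => (ω x * u (x.shift μ)) ^ 2)]
    simp only [shift_unshift]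
    rw [Finset.mul_sum]
    refine Finset.sum_le_sum fun y _ => ?_
    have h1 := weight_unshift_le ω ha hω₀ hω₁ y μ
    have h2 : 0 < ω (y.unshift μ) := hω₀ _
    have h3 : ω (y.unshift μ) ^ 2 ≤ 9 / 4 * ω y ^ 2 := by nlinarith
    rw [mul_pow, mul_pow]
    nlinarith [sq_nonneg (u y)]
  have hu : ∀ μ : Fin P.d, ∑ x : Site P j, (ω x * u (x.unshift μ)) ^ 2 ≤ 9 / 4 * ∑ x : Site P j, (ω x * u x) ^ 2 := by
    intro μ
    rw [← sum_comp_shift μ (fun x => (ω x * u (x.unshift μ)) ^ 2)]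
    simp only [unshift_shift]
    rw [Finset.mul_sum]
    refine Finset.sum_le_sum fun y _ => ?_
    have h1 := weight_shift_le ω ha hω₀ hω₁ y μ
    have h2 : 0 < ω (y.shift μ) := hω₀ _
    have h3 : ω (y.shift μ) ^ 2 ≤ 9 / 4 * ω y ^ 2 := by nlinarith
    rw [mul_pow, mul_pow]
    nlinarith [sq_nonneg (u y)]
  set N2 := ∑ x : Site P j, (ω x * u x) ^ 2 with hN2
  calc ∑ x : Site P j, (ω x * laplace c u x) ^ 2
      ≤ ∑ x : Site P j, 3 * P.d * c ^ 4 * ∑ μ : Fin P.d, (4 * (ω x * u x) ^ 2 + (ω x * u (x.shift μ)) ^ 2 + (ω x * u (x.unshift μ)) ^ 2) :=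
        Finset.sum_le_sum fun x _ => sq_weighted_laplace_le c ω u x
    _ = 3 * P.d * c ^ 4 * ∑ μ : Fin P.d, (4 * N2 + ∑ x : Site P j, (ω x * u (x.shift μ)) ^ 2
          + ∑ x : Site P j, (ω x * u (x.unshift μ)) ^ 2) := by
        rw [← Finset.mul_sum, Finset.sum_comm]
        congr 1
        refine Finset.sum_congr rfl fun μ _ => ?_
        rw [Finset.sum_add_distrib, Finset.sum_add_distrib, hN2, Finset.mul_sum]
    _ ≤ 3 * P.d * c ^ 4 * ∑ _μ : Fin P.d, (4 * N2 + 9 / 4 * N2 + 9 / 4 * N2) := by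
        apply mul_le_mul_of_nonneg_left _ (by positivity)
        exact Finset.sum_le_sum fun μ _ => by linarith [hs μ, hu μ]
    _ = 3 * P.d * c ^ 4 * (P.d * (17 / 2 * N2)) := by
        rw [Finset.sum_const, Finset.card_univ, Fintype.card_fin, nsmul_eq_mul]; ring
    _ ≤ 26 * (P.d : ℝ) ^ 2 * c ^ 4 * N2 := by
        have : 0 ≤ N2 := Finset.sum_nonneg fun _ _ => sq_nonneg _
        nlinarith [mul_nonneg (mul_nonneg hd hd) (mul_nonneg (by positivity : (0:ℝ) ≤ c ^ 4) this)]

/-- ★ **THE PIN-RESTRICTED BOUND ON THE SCREENING CHARGES**: for any finite set of sites `S` (e.g. the centres `C`),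
`Σ_{y∈S} (ω(y)·(Δ²w)(y))² ≤ 26d²c⁴·Σ_x (ω(x)·(Δw)(x))²` — with `w = w_b` the pinned dipole solution and ✓ `…AgmonDecay.weighted_laplace_le_core`
this is the weighted `ℓ²` size of `q_b = Δ²w_b|_C` ((A3′) of ★routeR-w3 g5 19:08:11Z). [cite: Balaban1984PropagatorsI, (1.21) p.21] -/
theorem sum_sq_weighted_bilaplace_on_le (c : ℝ) (ω w : SiteField P j ℝ) (S : Finset (Site P j)) {a : ℝ} (ha : a ≤ 1 / 2)
    (hω₀ : ∀ x, 0 < ω x) (hω₁ : ∀ x μ, |ω (x.shift μ) - ω x| ≤ a * ω x ∧ |ω (x.unshift μ) - ω x| ≤ a * ω x) :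
    ∑ y ∈ S, (ω y * laplace c (laplace c w) y) ^ 2
      ≤ 26 * (P.d : ℝ) ^ 2 * c ^ 4 * ∑ x : Site P j, (ω x * laplace c w x) ^ 2 :=
  (Finset.sum_le_univ_sum_of_nonneg fun _ => sq_nonneg _).trans (sum_sq_weighted_laplace_le c ω (laplace c w) ha hω₀ hω₁)

end Summit.QuantumFields.YangMills.Theorems.Prop7PinnedBiharmonicAgmonPinCharges

end
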